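import Literature.MathematicalPhysics.QuantumFieldTheory.Balaban1983to89.Node00.HistoryTermDatum214

/-!
# NODE 00 (YM-PLAN Track A) — W1 = [II] §2 (2.13)–(2.14), STOREY 15: THE FREE (2.14) TERM DATUM OF RECORD, NAMED
# (`W1.TermDatum214.free`, its `rfl` faces and kernel projections; the two term-label kinds `W1.termLabelSmall ∕ W1.termLabelLarge`)

NODE 00 DEFINER MODULE (seat `pub-ymgap-node00-def-W1`, generation 20, 2026-08-27).  APPEND-ONLY: a NEW importing module; g7's
`Node00/HistoryTermDatum214` (`W1.TermDatum214`, `TF`, `A`, `Gam`, `lastLine`, §5 `nonempty_termDatum214`) and NODE A's `B13TermWalkDataOneTorus`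
(`freeKernels`) untouched and CONSUMED BY NAME.  Typed on the pub-ymgap bus word of seat `pub-ymgap-dag-n22-c` g8 (2026-08-27, ANSWER-№193 (c):
the A6 in-file inhabitation witnesses of its record `YMDAG.N22.W1.SliceInputsLG` — some 120 fields, every kernel letter stated through
`(𝔇.𝒦 Z t).…` — «need a CONCRETE datum; node00-def-W1 W1-7 has the degenerate one (`nonempty_termDatum214`: `freeKernels` on ONE row bond,
zero boxes ∕ potentials)», split by the two label kinds `P(t) = ∅` ∕ `P(t) ≠ ∅`).  THE POINT: W1-7 §5's `nonempty_termDatum214 :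
Nonempty (TermDatum214 c P 𝔸 M k L)` is an OPAQUE existential — its witness is an anonymous constructor inside the proof, so NO field of
`Classical.choice` of it computes and no kernel letter can be proved «at that datum».  A witness at the degenerate datum needs the datum AS A
TERM; under the one-declarer rule that term is a W1-7 object, and THIS STOREY NAMES IT.
[II] = [Balaban1988RG2Cluster] T. Bałaban, *Renormalization group approach to lattice gauge field theories. II. Cluster expansions*, Commun.
Math. Phys. **116** (1988) 1–22; [I] = [Balaban1987RG1], part I, Commun. Math. Phys. **109** (1987) 249–301.

CITATION HEADER (PDF held: `paper:balaban1988-cmp116-rg-ii-cluster`, journal page = PDF page; `paper:balaban1987-cmp109-rg-i-small-field`,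
journal page = PDF page + 248).  [II] p. 15 (2.14): the term `T_{(𝐃,P)}(Z)` assembled from `C^{(k)}(Z₀,σ(Z))⁻¹`, `Γ_k(Z₀,σ(Z))`, the
characteristic functions of (2.3) and `exp[Σ_{Y∈𝐃} τ(Y)𝐕_k(Y, B)]`, *"We consider it as an analytic function … of the complex parameters σ(Z),
τ"*; p. 12 (2.2)–(2.3): `χ_k = χ_{k,Y₀} χ_{k,Y₀ᶜ} = Σ_P (−1)^{|P|} χ_{k,Y₀} χᶜ_{k,P}` — the terms are labelled by `(𝐃, P)`, `P` a set of bonds,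
and BOTH `P = ∅` (the pure small-field term) and `P ≠ ∅` occur; p. 11 Lemma 2 (1.41): the potentials `𝐕_k(Y, 𝐔_{k+1}, B)`; [I] p. 268
(2.12)–(2.13): the recursion the terms feed.  NOTHING of these displays is instantiated below except at DEGENERATE data.

WHAT IS TYPED (degenerate data; definitions + `rfl` ∕ `simp` bookkeeping; nothing of print's):
* §1 **`TermDatum214.free c P 𝔸 M k L : TermDatum214 c P 𝔸 M k L`** — W1-7 §5's witness VERBATIM, as a `def`: the zero-dimensional site torus
  (`ν := 0`, `Nf := ![]`, its one point `TermDatum214.freePt`), configuration space `E₃ := ℂ`, NODE A's FREE kernel record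
  `𝒦 Z t := B13TermWalkDataOneTorus.freeKernels c ℂ Unit Empty (fun _ ↦ freePt) (fun _ ↦ freePt)` BY NAME (ONE row bond `Λ := Unit`, no extra
  columns `C₀ := Empty`, `A(σ,u) = 1`, `G(σ,u) = 0`, `Γ₀ = 0`, `C = 1`, `X = ∅`, `m = |Λ|`), zero configuration reading `uOf := 0`, Cauchy radius
  `r := 1`, zero characteristic functions `chiY₀ := 0`, `chicP := 0` and zero potentials `𝒱 := 0`.  Faces: `free_ν`, `free_Nf`, `free_E₃`, `free_r`,
  **`free_𝒦`** (the kernel record IS NODE A's free record — `rfl`; deliberately NOT `@[simp]`: use `rw [free_𝒦]` ∕ `dsimp only [free_𝒦]`, then NODE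
  A's free-term facts `B13TermWalkDataOneTorus.*` apply by name), the kernel projections `free_A2` (= 1), `free_G2` (= 0), `free_Γ₀` (= 0), `free_C`
  (= 1), `free_X` (= ∅), `free_m` (= 1), `free_locΛ`, `free_locN` (= `freePt`), the readings `free_uOf` (= 0), `free_chiY₀`, `free_chicP`, `free_𝒱`
  (= 0), and the derived `free_A` (`𝔇.A Z t φ σ = 1`), `free_Gam` (`𝔇.Gam Z t φ σ X = 0`), `free_lastLine` (the last line of (2.14) vanishes:
  `χ_{k,Y₀} ≡ 0`).  `⟨TermDatum214.free …⟩` re-proves W1-7's `nonempty_termDatum214` (not restated).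
* §2 **THE TWO LABEL KINDS EXIST AT EVERY STEP**: `termBond₀` (a bond of the level-`k` torus, from `Params.hd : 1 ≤ d`), `termLabelSmall 𝐃 := (𝐃, ∅)`,
  `termLabelLarge 𝐃 b := (𝐃, {b})` with the faces `termLabelSmall_snd`, `termLabelLarge_snd`, `termLabelLarge_snd_ne_empty`, `card_termLabelLarge_snd`,
  and `exists_termLabel_snd_eq_empty : ∃ t, t.2 = ∅`, `exists_termLabel_snd_ne_empty : ∃ t, t.2 ≠ ∅`, `exists_termLabel_one_le_card_snd :
  ∃ t, 1 ≤ t.2.card` — both branches of a consumer's `P(t) = ∅ ∕ P(t) ≠ ∅` split are populated.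
* §3 HONESTY CENSUS (docstring only; nothing declared) — WHICH W1 RECORDS ARE INHABITED IN THE TREE, BY WHOM: the datum Type (W1-7 §5, and §1 here
  by name); W1-12's binder records at ZERO potentials ∕ CONSTANT boxes (`TermDatum214.localGrowthInputsZero`, `localGrowthLetters_zero`,
  `unscaledBoxLaws_const` — ALREADY LANDED in `Node00/HistoryTermDatum214LocalGrowth` §3, NOT restated here); W1-13 `AdmHist_nonempty`; W1-14
  `nonempty_germIdx`; the rate-record readings `RateRecordW1Reading.nonempty_readingData ∕ nonempty_assignmentInputs₁₁ ∕ nonempty_assignmentInputs₁₂`,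
  `RateRecordW1MapsAdm.AdmBg.nonempty_of_mem ∕ nonempty_spGen_of_strict`; W1-8's `Inputs226Holo` Summit-side from NODE A's walk record (seat
  `pub-ymgap-dag-n18-c`, `inputs226Holo_on_of_termWalkData`).  NOT inhabited in the tree (no claim is made): W1-8 `Inputs226` at a general datum, W1-12b
  `Lemma2Inputs` ∕ `AnalyticGrowthInputs` (Lemma 2's analytic letters — NODE A ∕ N10 currency), and the CONSUMER records over the datum (`SliceInputsLG`
  and kin — their declarers' witnesses, not typed here).

WHAT IT IS FOR: a consumer's A6 witness over the (2.14) datum opens with `𝔇 := TermDatum214.free c P 𝔸 M k L`, rewrites `𝔇.𝒦 Z t` to NODE A's free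
record by `free_𝒦` and every reading by the `free_*` faces, and picks `termLabelSmall ∕ termLabelLarge` for the two label kinds — instead of
re-declaring W1-7's datum in a consumer namespace.  WHAT IS LEFT TO THE CONSUMERS (one declarer each): the witnesses of THEIR records at this datum.

HONEST FRAMING: definitions + `rfl` ∕ `simp` bookkeeping on DEGENERATE data; nothing of Bałaban's asserted or constructed; NO estimate; the free
datum is a consistency device, NOT NODE 00's datum of record (NODE A's kernels, Lemma 2's potentials, [I] (2.9)'s boxes); N22 ∕ N18 ∕ N10 ∕ N09 NOT
discharged; K3 untouched; counts unmoved; one finite 𝕋⁴ programme at fixed ε, Bałaban as printed — NOT continuum ∕ ℝ⁴ ∕ infinite volume ∕ OS ∕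
mass gap ∕ Clay.  No `sorry`, no `axiom`, no `instance` declaration, no `notation`.

References (TYPES and page anchors only): [II] Lemma 2 (1.41) p.11, (2.2)–(2.3) p.12, p.13, (2.14) p.15; [I] (2.9) p.266, (2.12)–(2.13) p.268.
-/

open scoped BigOperators

noncomputable section

namespace Literature.MathematicalPhysics.QuantumFieldTheory.Balaban1983to89.Node00

open Metric Set Matrix
open Literature.MathematicalPhysics.QuantumFieldTheory.Balaban1983to89
open Step B14.Eq213MaximalDomains TreeLengthTorus T4Continuum Sect2
open Literature.MathematicalPhysics.QuantumFieldTheory.Balaban1983to89.B13Lemma3TorusData (TBond)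
open Literature.MathematicalPhysics.QuantumFieldTheory.Balaban1983to89.B13Term214 (F214)
open Literature.MathematicalPhysics.QuantumFieldTheory.Balaban1983to89.B13TermWalkData (TermKernels)
open Literature.MathematicalPhysics.QuantumFieldTheory.Balaban1983to89.B13TermWalkDataOneTorus (freeKernels)
open Literature.MathematicalPhysics.QuantumFieldTheory.Balaban1983to89.B5TorusCover (UT)

namespace W1

/-! ## §1  The free (2.14) term datum of record, named -/

namespace TermDatum214

section Free

variable (c : B13.Consts) (P : Params) (𝔸 : Type*) (M k L : ℕ) [NeZero L]

/-- **The point of the zero-dimensional site torus** `UT ![]` (the location of the free datum's one row bond). Degenerate data.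
[cite: Balaban1988RG2Cluster, p.13 and (2.14) p.15 (degenerate data; bookkeeping)] -/
def freePt : UT (![] : Fin 0 → ℕ) := UT.ofSite (![] : Fin 0 → ℕ) fun i => i.elim0

/-- **THE FREE (2.14) TERM DATUM OF RECORD** — W1-7 §5's non-vacuity witness (`nonempty_termDatum214`), NAMED: the zero-dimensional site torus
(`ν := 0`, `Nf := ![]`), configuration space `ℂ`, NODE A's FREE kernel record `B13TermWalkDataOneTorus.freeKernels c ℂ Unit Empty` on ONE row bond
located at `freePt` (`A ≡ 1`, `G ≡ 0`, `Γ₀ = 0`, `C = 1`, `X = ∅`), zero configuration reading, Cauchy radius `1`, zero characteristic functions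
and zero potentials.  DEGENERATE DATA — a consistency device for in-file inhabitation witnesses over the datum; NOT NODE 00's datum of record,
nothing of print's. [cite: Balaban1988RG2Cluster, (2.14) p.15 and (2.3) p.12 (degenerate data; bookkeeping); Balaban1987RG1, (2.12)-(2.13) p.268] -/
def free : TermDatum214 c P 𝔸 M k L :=
  haveI : ∀ i : Fin 0, NeZero ((![] : Fin 0 → ℕ) i) := fun i => i.elim0
  { ν := 0, Nf := ![], E₃ := ℂ,
    𝒦 := fun _ _ => freeKernels c ℂ Unit Empty (fun _ => freePt) (fun _ => freePt),
    finC₀ := fun _ _ => inferInstanceAs (Fintype Empty),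
    decC₀ := fun _ _ => inferInstanceAs (DecidableEq Empty),
    uOf := fun _ _ _ => 0, r := 1,
    chiY₀ := fun _ _ _ _ => 0, chicP := fun _ _ _ _ => 0,
    𝒱 := fun _ _ _ _ _ _ _ => 0 }

/-! ### Faces of the free datum (`rfl`) -/

/-- Face: the site-torus dimension of the free datum is `0`. [cite: Balaban1988RG2Cluster, p.13 (degenerate data; bookkeeping)] -/
@[simp] theorem free_ν : (free c P 𝔸 M k L).ν = 0 := rfl

/-- Face: the site-torus periods of the free datum are the empty vector. [cite: Balaban1988RG2Cluster, p.13 (degenerate data; bookkeeping)] -/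
theorem free_Nf : (free c P 𝔸 M k L).Nf = ![] := rfl

/-- Face: the configuration space of the free datum is `ℂ`. [cite: Balaban1988RG2Cluster, (2.14) p.15 (degenerate data; bookkeeping)] -/
theorem free_E₃ : (free c P 𝔸 M k L).E₃ = ℂ := rfl

/-- Face: the Cauchy radius of the free datum is `1`. [cite: Balaban1988RG2Cluster, (2.14) p.15 (degenerate data; bookkeeping)] -/
@[simp] theorem free_r : (free c P 𝔸 M k L).r = 1 := rfl

/-- **Face: the kernel record of the free datum IS NODE A's free record** `freeKernels c ℂ Unit Empty (fun _ ↦ freePt) (fun _ ↦ freePt)` at every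
`(Z, t)` (`rfl`).  Deliberately not `@[simp]` (it would compete with the projection faces below): use `rw [free_𝒦]` ∕ `dsimp only [free_𝒦]`, after
which NODE A's free-term facts (`B13TermWalkDataOneTorus`) apply by name. [cite: Balaban1988RG2Cluster, p.13 and (2.14) p.15 (degenerate data; bookkeeping)] -/
theorem free_𝒦 (Z : (domSys P M (k + 1)).Dom) (t : TermLabel P M k L) :
    (free c P 𝔸 M k L).𝒦 Z t =
      haveI : ∀ i : Fin 0, NeZero ((![] : Fin 0 → ℕ) i) := fun i => i.elim0
      freeKernels c ℂ Unit Empty (fun _ => freePt) (fun _ => freePt) := rfl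

/-- Face: the row-bond type of the free datum's kernels is `Unit` (one row bond). [cite: Balaban1988RG2Cluster, (2.14) p.15 (degenerate data; bookkeeping)] -/
theorem free_Λ (Z : (domSys P M (k + 1)).Dom) (t : TermLabel P M k L) : ((free c P 𝔸 M k L).𝒦 Z t).Λ = Unit := rfl

/-- Face: the extra-column type of the free datum's kernels is `Empty`. [cite: Balaban1988RG2Cluster, (2.14) p.15 (degenerate data; bookkeeping)] -/
theorem free_C₀ (Z : (domSys P M (k + 1)).Dom) (t : TermLabel P M k L) : ((free c P 𝔸 M k L).𝒦 Z t).C₀ = Empty := rfl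

/-- Face: the precision `A(σ,u) = C^{(k)}(Z₀,σ(Z))⁻¹` of the free datum is the identity. [cite: Balaban1988RG2Cluster, (2.14) p.15 (degenerate data; bookkeeping)] -/
@[simp] theorem free_A2 (Z : (domSys P M (k + 1)).Dom) (t : TermLabel P M k L) (σ : TPt P.d (domCount P M (k + 1)) → ℂ)
    (u : (free c P 𝔸 M k L).E₃) : ((free c P 𝔸 M k L).𝒦 Z t).A2 σ u = 1 := rfl

/-- Face: the Γ-kernel `G(σ,u)` of the free datum vanishes. [cite: Balaban1988RG2Cluster, (2.14) p.15 (degenerate data; bookkeeping)] -/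
@[simp] theorem free_G2 (Z : (domSys P M (k + 1)).Dom) (t : TermLabel P M k L) (σ : TPt P.d (domCount P M (k + 1)) → ℂ)
    (u : (free c P 𝔸 M k L).E₃) : ((free c P 𝔸 M k L).𝒦 Z t).G2 σ u = 0 := rfl

/-- Face: the real reference `Γ₀` of the free datum vanishes. [cite: Balaban1988RG2Cluster, (2.14) p.15 (degenerate data; bookkeeping)] -/
@[simp] theorem free_Γ₀ (Z : (domSys P M (k + 1)).Dom) (t : TermLabel P M k L) : ((free c P 𝔸 M k L).𝒦 Z t).Γ₀ = 0 := rfl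

/-- Face: the real covariance reference `C` of the free datum is the identity. [cite: Balaban1988RG2Cluster, (2.14) p.15 (degenerate data; bookkeeping)] -/
@[simp] theorem free_C (Z : (domSys P M (k + 1)).Dom) (t : TermLabel P M k L) : ((free c P 𝔸 M k L).𝒦 Z t).C = 1 := rfl

/-- Face: the σ-structure set `X` of the free datum is empty. [cite: Balaban1988RG2Cluster, p.13 (degenerate data; bookkeeping)] -/
@[simp] theorem free_X (Z : (domSys P M (k + 1)).Dom) (t : TermLabel P M k L) : ((free c P 𝔸 M k L).𝒦 Z t).X = ∅ := rfl

/-- Face: the column fibre bound `m` of the free datum is `1` (`= |Unit|`). [cite: Balaban1988RG2Cluster, (2.16) p.16 (degenerate data; bookkeeping)] -/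
@[simp] theorem free_m (Z : (domSys P M (k + 1)).Dom) (t : TermLabel P M k L) : ((free c P 𝔸 M k L).𝒦 Z t).m = 1 := rfl

/-- Face: every row bond of the free datum is located at `freePt`. [cite: Balaban1988RG2Cluster, p.13 (degenerate data; bookkeeping)] -/
@[simp] theorem free_locΛ (Z : (domSys P M (k + 1)).Dom) (t : TermLabel P M k L) (b : ((free c P 𝔸 M k L).𝒦 Z t).Λ) :
    ((free c P 𝔸 M k L).𝒦 Z t).locΛ b = freePt := rfl

/-- Face: every column of the free datum is located at `freePt`. [cite: Balaban1988RG2Cluster, p.13 (degenerate data; bookkeeping)] -/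
@[simp] theorem free_locN (Z : (domSys P M (k + 1)).Dom) (t : TermLabel P M k L)
    (j : ((free c P 𝔸 M k L).𝒦 Z t).Λ ⊕ ((free c P 𝔸 M k L).𝒦 Z t).C₀) : ((free c P 𝔸 M k L).𝒦 Z t).locN j = freePt := rfl

/-- Face: the configuration reading of the free datum is `0`. [cite: Balaban1988RG2Cluster, (2.14) p.15 (degenerate data; bookkeeping)] -/
@[simp] theorem free_uOf (Z : (domSys P M (k + 1)).Dom) (t : TermLabel P M k L) (φ : CPair P 𝔸) : (free c P 𝔸 M k L).uOf Z t φ = 0 := rfl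

/-- Face: the small-field characteristic function `χ_{k,Y₀}` of the free datum is `0`. [cite: Balaban1988RG2Cluster, (2.3) p.12 (degenerate data; bookkeeping)] -/
@[simp] theorem free_chiY₀ (Z : (domSys P M (k + 1)).Dom) (t : TermLabel P M k L) (s : ℂ) (B : ((free c P 𝔸 M k L).𝒦 Z t).Λ → ℝ) :
    (free c P 𝔸 M k L).chiY₀ Z t s B = 0 := rfl

/-- Face: the large-field characteristic function `χᶜ_{k,P}` of the free datum is `0`. [cite: Balaban1988RG2Cluster, (2.3) p.12 (degenerate data; bookkeeping)] -/
@[simp] theorem free_chicP (Z : (domSys P M (k + 1)).Dom) (t : TermLabel P M k L) (s : ℂ) (B : ((free c P 𝔸 M k L).𝒦 Z t).Λ → ℝ) :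
    (free c P 𝔸 M k L).chicP Z t s B = 0 := rfl

/-- Face: the potentials `𝐕_k(Y, ·)` of the free datum are `0`. [cite: Balaban1988RG2Cluster, (1.41) p.11 (degenerate data; bookkeeping)] -/
@[simp] theorem free_𝒱 (Z : (domSys P M (k + 1)).Dom) (t : TermLabel P M k L) (s : ℂ) (old : OlderTerms P 𝔸 M k) (φ : CPair P 𝔸)
    (Y : TDom P.d (L * domCount P M (k + 1))) (B : ((free c P 𝔸 M k L).𝒦 Z t).Λ → ℝ) :
    (free c P 𝔸 M k L).𝒱 Z t s old φ Y B = 0 := rfl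

/-! ### Derived faces: the assembled objects of (2.14) at the free datum -/

/-- **`A(σ) = 1` at the free datum** (the precision at the configuration, W1-7 `TermDatum214.A`). [cite: Balaban1988RG2Cluster, (2.14) p.15 (degenerate data; bookkeeping)] -/
@[simp] theorem free_A (Z : (domSys P M (k + 1)).Dom) (t : TermLabel P M k L) (φ : CPair P 𝔸) (σ : TPt P.d (domCount P M (k + 1)) → ℂ) :
    (free c P 𝔸 M k L).A Z t φ σ = 1 := rfl

/-- **`Γ(σ)X = 0` at the free datum** (W1-7 `TermDatum214.Gam`: `G(σ,u)·X` with `G ≡ 0`). [cite: Balaban1988RG2Cluster, (2.14) p.15 (degenerate data; bookkeeping)] -/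
@[simp] theorem free_Gam (Z : (domSys P M (k + 1)).Dom) (t : TermLabel P M k L) (φ : CPair P 𝔸) (σ : TPt P.d (domCount P M (k + 1)) → ℂ)
    (X : ((free c P 𝔸 M k L).𝒦 Z t).Λ ⊕ ((free c P 𝔸 M k L).𝒦 Z t).C₀ → ℝ) : (free c P 𝔸 M k L).Gam Z t φ σ X = 0 := by
  rw [Gam_eq, free_G2]; exact Matrix.zero_mulVec _

/-- **The last line of (2.14) vanishes at the free datum** (`(−1)^{|P|} χ_{k,Y₀} χᶜ_{k,P} exp[Σ τ(Y)𝐕_k(Y,B)]` with `χ_{k,Y₀} ≡ 0`; W1-7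
`TermDatum214.lastLine` = `B13Term214.F214` by name). [cite: Balaban1988RG2Cluster, (2.14) p.15 and (2.3) p.12 (degenerate data; bookkeeping)] -/
@[simp] theorem free_lastLine (Z : (domSys P M (k + 1)).Dom) (t : TermLabel P M k L) (s : ℂ) (old : OlderTerms P 𝔸 M k) (φ : CPair P 𝔸)
    (τ : TDom P.d (L * domCount P M (k + 1)) → ℂ) (B : ((free c P 𝔸 M k L).𝒦 Z t).Λ → ℝ) :
    (free c P 𝔸 M k L).lastLine Z t s old φ τ B = 0 := by
  simp [lastLine, F214]

end Free

end TermDatum214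

/-! ## §2  The two term-label kinds exist at every step (`P(t) = ∅` and `P(t) ≠ ∅`) -/

section LabelKinds

variable (P : Params) (M k L : ℕ) [NeZero L]

/-- **A bond of the level-`k` torus** (the origin, direction `0` — the lattice dimension is `≥ 1`, `Params.hd`). Bookkeeping only.
[cite: Balaban1988RG2Cluster, (2.2)-(2.3) p.12 (bookkeeping)] -/
def termBond₀ : TBond P.d M (L * domCount P M (k + 1)) := (0, ⟨0, P.hd⟩)

variable {P M k L}

/-- **The pure small-field label `(𝐃, ∅)`** — print's term with `P = ∅` in the decomposition (2.3). [cite: Balaban1988RG2Cluster, (2.2)-(2.3) p.12 (bookkeeping)] -/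
def termLabelSmall (D : Finset (TDom P.d (L * domCount P M (k + 1)))) : TermLabel P M k L := (D, ∅)

/-- **A large-field label `(𝐃, {b})`** — print's term with the one-bond set `P = {b}` in the decomposition (2.3).
[cite: Balaban1988RG2Cluster, (2.2)-(2.3) p.12 (bookkeeping)] -/
def termLabelLarge (D : Finset (TDom P.d (L * domCount P M (k + 1)))) (b : TBond P.d M (L * domCount P M (k + 1))) : TermLabel P M k L :=
  (D, {b})

/-- Face: the domain family of the small-field label. [cite: Balaban1988RG2Cluster, (2.2)-(2.3) p.12 (bookkeeping)] -/
@[simp] theorem termLabelSmall_fst (D : Finset (TDom P.d (L * domCount P M (k + 1)))) : (termLabelSmall D : TermLabel P M k L).1 = D := rfl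

/-- Face: the bond set of the small-field label is empty. [cite: Balaban1988RG2Cluster, (2.2)-(2.3) p.12 (bookkeeping)] -/
@[simp] theorem termLabelSmall_snd (D : Finset (TDom P.d (L * domCount P M (k + 1)))) : (termLabelSmall D : TermLabel P M k L).2 = ∅ := rfl

/-- Face: the domain family of the large-field label. [cite: Balaban1988RG2Cluster, (2.2)-(2.3) p.12 (bookkeeping)] -/
@[simp] theorem termLabelLarge_fst (D : Finset (TDom P.d (L * domCount P M (k + 1)))) (b : TBond P.d M (L * domCount P M (k + 1))) :
    (termLabelLarge D b : TermLabel P M k L).1 = D := rfl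

/-- Face: the bond set of the large-field label is `{b}`. [cite: Balaban1988RG2Cluster, (2.2)-(2.3) p.12 (bookkeeping)] -/
@[simp] theorem termLabelLarge_snd (D : Finset (TDom P.d (L * domCount P M (k + 1)))) (b : TBond P.d M (L * domCount P M (k + 1))) :
    (termLabelLarge D b : TermLabel P M k L).2 = {b} := rfl

/-- Face: the bond set of the large-field label is nonempty. [cite: Balaban1988RG2Cluster, (2.2)-(2.3) p.12 (bookkeeping)] -/
theorem termLabelLarge_snd_ne_empty (D : Finset (TDom P.d (L * domCount P M (k + 1)))) (b : TBond P.d M (L * domCount P M (k + 1))) :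
    (termLabelLarge D b : TermLabel P M k L).2 ≠ ∅ :=
  Finset.singleton_ne_empty b

/-- Face: the bond set of the large-field label has exactly one bond. [cite: Balaban1988RG2Cluster, (2.2)-(2.3) p.12 (bookkeeping)] -/
@[simp] theorem card_termLabelLarge_snd (D : Finset (TDom P.d (L * domCount P M (k + 1)))) (b : TBond P.d M (L * domCount P M (k + 1))) :
    (termLabelLarge D b : TermLabel P M k L).2.card = 1 :=
  Finset.card_singleton b

variable (P M k L)

/-- **Small-field labels exist**: some term label has `P(t) = ∅`. [cite: Balaban1988RG2Cluster, (2.2)-(2.3) p.12 (bookkeeping)] -/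
theorem exists_termLabel_snd_eq_empty : ∃ t : TermLabel P M k L, t.2 = ∅ := ⟨termLabelSmall ∅, rfl⟩

/-- **Large-field labels exist**: some term label has `P(t) ≠ ∅`. [cite: Balaban1988RG2Cluster, (2.2)-(2.3) p.12 (bookkeeping)] -/
theorem exists_termLabel_snd_ne_empty : ∃ t : TermLabel P M k L, t.2 ≠ ∅ :=
  ⟨termLabelLarge ∅ (termBond₀ P M k L), termLabelLarge_snd_ne_empty _ _⟩

/-- **Large-field labels exist** (cardinality form): some term label has `1 ≤ |P(t)|`. [cite: Balaban1988RG2Cluster, (2.2)-(2.3) p.12 (bookkeeping)] -/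
theorem exists_termLabel_one_le_card_snd : ∃ t : TermLabel P M k L, 1 ≤ t.2.card :=
  ⟨termLabelLarge ∅ (termBond₀ P M k L), (card_termLabelLarge_snd _ _).ge⟩

end LabelKinds

end W1

end Literature.MathematicalPhysics.QuantumFieldTheory.Balaban1983to89.Node00

end
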